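import Literature.Algebra.GroupRings.MaschkeTheoremGeneralRing
import Mathlib.GroupTheory.Index
import Mathlib.GroupTheory.GroupAction.Quotient
import Mathlib.Tactic.Group
import HarnessLib

/-!
# Lam §6 Exercise 6.1: Maschke's theorem relative to a subgroup of finite invertible index

[cite: Lam2001FirstCourse, §6 Exercise 6.1, p. 97]

Lam, *A First Course in Noncommutative Rings*, Exercises for §6 (p. 97; p0109 of the held scan):

**Ex. 6.1.** Let `V` be a `kG`-module and `H` be a subgroup in `G` of finite index `n` not divisible by `char k`. Modify the proof of
Maschke's Theorem to show the following: If `V` is semisimple as a `kH`-module, then `V` is semisimple as a `kG`-module.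

As in the tree's `MaschkeTheoremGeneralRing` (the case `H = 1`), `k` is any ring, `kG`-modules carry a compatible `k`-structure
(`IsScalarTower k kG V`), «not divisible by `char k`» is «`n·1 ∈ k×`», and `kH`-linearity of a `k`-linear map is spelled
`f(h·w) = h·f(w)` for `h ∈ H`. The averaging now runs over a system of left coset representatives `σ_q` (`q ∈ G/H`):
`g(w) = n⁻¹ Σ_q σ_q f(σ_q⁻¹ w)`; for `τ ∈ G` one has `σ_q = τ σ_{τ⁻¹q} h_q` with `h_q ∈ H`, and `kH`-linearity of `f` absorbs `h_q`.

* `exists_equivariant_retraction_of_isUnit_index` — a `kG`-linear map with a `kH`-linear retraction has a `kG`-linear retraction;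
* `exists_isCompl_of_isUnit_index` — a `kG`-submodule with an `H`-stable `k`-complement has a `kG`-complement;
* `isSemisimpleModule_of_isUnit_index` — **Ex. 6.1**: if every `kG`-submodule of `V` has an `H`-stable `k`-complement (in particular if
  `V` is semisimple as a `kH`-module), then `V` is a semisimple `kG`-module.

## References

* [Lam2001FirstCourse] T. Y. Lam, *A First Course in Noncommutative Rings*, 2nd ed., Graduate Texts in Mathematics 131, Springer, 2001,
  §6 Exercise 6.1, p. 97 (held scan `book:lamnd-first-course-noncommutative-rings`, p0109); proof of Thm. (6.1), pp. 79–80.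
-/

universe u v v' w

namespace Literature.Algebra.GroupRings

open MonoidAlgebra

variable {k : Type u} [Ring k] {G : Type w} [Group G]
variable {V : Type v} [AddCommGroup V] [Module k V] [Module (MonoidAlgebra k G) V] [IsScalarTower k (MonoidAlgebra k G) V]
variable {W : Type v'} [AddCommGroup W] [Module k W] [Module (MonoidAlgebra k G) W] [IsScalarTower k (MonoidAlgebra k G) W]

/-- Coset representatives under translation: for `τ ∈ G` and `q ∈ G/H`, `σ_{τ⁻¹q} = τ⁻¹ σ_q h` for some `h ∈ H` (`σ_q = q.out`).
[cite: Lam2001FirstCourse, §6 Exercise 6.1] -/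
theorem exists_out_inv_smul_eq (H : Subgroup G) (τ : G) (q : G ⧸ H) : ∃ h ∈ H, (τ⁻¹ • q).out = τ⁻¹ * q.out * h := by
  refine ⟨(τ⁻¹ * q.out)⁻¹ * (τ⁻¹ • q).out, ?_, by rw [mul_inv_cancel_left]⟩
  rw [← QuotientGroup.eq, QuotientGroup.out_eq']
  exact MulAction.Quotient.coe_smul_out (H := H) τ⁻¹ q

/-- **Maschke's averaging relative to `H ≤ G` of finite index `n` with `n·1 ∈ k×`**: a `kG`-linear map `i : V → W` admitting a
`k`-linear retraction `f` which is `kH`-linear (`f(hw) = h f(w)`, `h ∈ H`) admits a `kG`-linear retraction, namely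
`g(w) = n⁻¹ Σ_{q ∈ G/H} σ_q f(σ_q⁻¹ w)`. [cite: Lam2001FirstCourse, §6 Exercise 6.1; proof of Thm. (6.1)] -/
theorem exists_equivariant_retraction_of_isUnit_index (H : Subgroup G) [H.FiniteIndex] (hidx : IsUnit (H.index : k))
    (i : V →ₗ[MonoidAlgebra k G] W) (f : W →ₗ[k] V)
    (hfH : ∀ h ∈ H, ∀ w : W, f (single h (1 : k) • w) = single h (1 : k) • f w) (hf : ∀ v : V, f (i v) = v) :
    ∃ g : W →ₗ[MonoidAlgebra k G] V, ∀ v : V, g (i v) = v := by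
  classical
  haveI : Fintype (G ⧸ H) := Fintype.ofFinite _
  obtain ⟨u, hu⟩ := hidx
  -- `c = n⁻¹` is central in `k`
  set c : k := ↑u⁻¹ with hc
  have hcomm : ∀ a : k, Commute a c := fun a ↦ by
    have h : Commute a (u : k) := by rw [hu]; exact (Nat.cast_commute _ a).symm
    exact h.units_inv_right
  -- coset representatives `σ_q`
  let σ : G ⧸ H → G := Quotient.out
  -- the averaged map
  let g₀ : W → V := fun w ↦ c • ∑ q : G ⧸ H, single (σ q) (1 : k) • f (single (σ q)⁻¹ (1 : k) • w)
  have hadd : ∀ w w' : W, g₀ (w + w') = g₀ w + g₀ w' := fun w w' ↦ by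
    simp only [g₀, smul_add, map_add, Finset.sum_add_distrib]
  have hk : ∀ (a : k) (w : W), g₀ (a • w) = a • g₀ w := fun a w ↦ by
    simp only [g₀]
    simp_rw [single_one_smul_comm (V := W), map_smul, single_one_smul_comm (V := V), ← Finset.smul_sum, smul_smul, (hcomm a).eq]
  -- `g(τ w) = τ g(w)`: reindex by `q ↦ τ⁻¹ q` and absorb the `H`-factor with the `kH`-linearity of `f`
  have hterm : ∀ (τ : G) (w : W) (q : G ⧸ H), single (σ q) (1 : k) • f (single (σ q)⁻¹ (1 : k) • (single τ (1 : k) • w)) =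
      single τ (1 : k) • (single (σ (τ⁻¹ • q)) (1 : k) • f (single (σ (τ⁻¹ • q))⁻¹ (1 : k) • w)) := fun τ w q ↦ by
    obtain ⟨h, hh, hq⟩ := exists_out_inv_smul_eq H τ q
    -- `σ_q = τ σ' h⁻¹` with `σ' = σ_{τ⁻¹ q}`
    have hσ : σ q = τ * σ (τ⁻¹ • q) * h⁻¹ := by
      change q.out = τ * (τ⁻¹ • q).out * h⁻¹
      rw [hq]
      group
    set σ' : G := σ (τ⁻¹ • q)
    have e1 : (single (τ * σ' * h⁻¹)⁻¹ (1 : k) * single τ (1 : k) : MonoidAlgebra k G) = single h 1 * single σ'⁻¹ 1 := by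
      rw [single_mul_single, single_mul_single, one_mul]
      congr 1
      group
    have e2 : (single (τ * σ' * h⁻¹) (1 : k) * single h (1 : k) : MonoidAlgebra k G) = single τ 1 * single σ' 1 := by
      rw [single_mul_single, single_mul_single, one_mul]
      congr 1
      group
    rw [hσ, smul_smul, e1, mul_smul, hfH h hh, smul_smul, e2, mul_smul]
  have hG : ∀ (τ : G) (w : W), g₀ (single τ (1 : k) • w) = single τ (1 : k) • g₀ w := fun τ w ↦ by
    simp only [g₀]
    simp_rw [hterm τ w]
    rw [Fintype.sum_bijective (τ⁻¹ • ·) (MulAction.bijective τ⁻¹) _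
      (fun q ↦ single τ (1 : k) • (single (σ q) (1 : k) • f (single (σ q)⁻¹ (1 : k) • w))) fun q ↦ rfl]
    rw [← Finset.smul_sum, single_one_smul_comm]
  -- `g` is the identity on `V`: each summand is `v`, and there are `n = [G:H]` of them
  have hid : ∀ v : V, g₀ (i v) = v := fun v ↦ by
    simp only [g₀]
    simp_rw [← map_smul i, hf, smul_smul, single_mul_single, mul_inv_cancel, mul_one, ← one_def, one_smul, Finset.sum_const,
      Finset.card_univ, ← Nat.card_eq_fintype_card, ← Subgroup.index_eq_card, ← Nat.cast_smul_eq_nsmul k, smul_smul, hc, ← hu,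
      Units.inv_mul, one_smul]
  exact ⟨{ toFun := g₀, map_add' := hadd, map_smul' := map_smul_of_map_smul_of_map_single_one_smul hadd hk hG }, hid⟩

variable (H : Subgroup G) [H.FiniteIndex]

/-- **Ex. 6.1, complements: if `[G:H]·1 ∈ k×`, a `kG`-submodule `W₀ ≤ V` admitting an `H`-stable `k`-complement (i.e. a `kH`-complement)
admits a `kG`-complement.** [cite: Lam2001FirstCourse, §6 Exercise 6.1] -/
theorem exists_isCompl_of_isUnit_index (hidx : IsUnit (H.index : k)) (W₀ : Submodule (MonoidAlgebra k G) V)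
    (hW : ∃ W' : Submodule k V, (∀ h ∈ H, ∀ w ∈ W', single h (1 : k) • w ∈ W') ∧ IsCompl (W₀.restrictScalars k) W') :
    ∃ W'' : Submodule (MonoidAlgebra k G) V, IsCompl W₀ W'' := by
  obtain ⟨W', hW'H, hc⟩ := hW
  -- the projection `f : V → W₀` along `W'` is `kH`-linear
  let f : V →ₗ[k] W₀ := (Submodule.projectionOnto (W₀.restrictScalars k) W' hc : V →ₗ[k] W₀.restrictScalars k)
  have hf : ∀ w : W₀, f (W₀.subtype w) = w := fun w ↦ Submodule.projectionOnto_apply_left hc ⟨w, w.2⟩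
  have hfH : ∀ h ∈ H, ∀ v : V, f (single h (1 : k) • v) = single h (1 : k) • f v := fun h hh v ↦ by
    have hv : v ∈ W₀.restrictScalars k ⊔ W' := by rw [hc.sup_eq_top]; exact Submodule.mem_top
    obtain ⟨w₀, hw₀, w', hw', rfl⟩ := Submodule.mem_sup.1 hv
    have hw₀' : w₀ ∈ W₀ := hw₀
    have a1 : f w₀ = ⟨w₀, hw₀'⟩ := hf ⟨w₀, hw₀'⟩
    have b1 : f w' = 0 := Submodule.projectionOnto_apply_right hc ⟨w', hw'⟩
    have a2 : f (single h (1 : k) • w₀) = ⟨single h (1 : k) • w₀, W₀.smul_mem _ hw₀'⟩ :=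
      hf ⟨single h (1 : k) • w₀, W₀.smul_mem _ hw₀'⟩
    have b2 : f (single h (1 : k) • w') = 0 := Submodule.projectionOnto_apply_right hc ⟨single h (1 : k) • w', hW'H h hh w' hw'⟩
    rw [smul_add, map_add, map_add, a1, b1, a2, b2, add_zero, add_zero]
    rfl
  obtain ⟨g, hg⟩ := exists_equivariant_retraction_of_isUnit_index H hidx W₀.subtype f hfH hf
  exact ⟨LinearMap.ker g, LinearMap.isCompl_of_proj hg⟩

/-- **LAM Exercise 6.1: if `[G:H]` is finite with `[G:H]·1 ∈ k×` and every `kG`-submodule of `V` has an `H`-stable `k`-complement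
(e.g. `V` is semisimple as a `kH`-module), then `V` is a semisimple `kG`-module.** [cite: Lam2001FirstCourse, §6 Exercise 6.1] -/
theorem isSemisimpleModule_of_isUnit_index (hidx : IsUnit (H.index : k))
    (hV : ∀ W₀ : Submodule (MonoidAlgebra k G) V,
      ∃ W' : Submodule k V, (∀ h ∈ H, ∀ w ∈ W', single h (1 : k) • w ∈ W') ∧ IsCompl (W₀.restrictScalars k) W') :
    IsSemisimpleModule (MonoidAlgebra k G) V where
  exists_isCompl W₀ := exists_isCompl_of_isUnit_index H hidx W₀ (hV W₀)

end Literature.Algebra.GroupRings
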